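import Summits.Ventures.HSemireg.WedgeWeilOneSided
import Summits.Ventures.HSemireg.WedgeHankelDual

/-!
# Venture HSemireg — the W-PURITY structure theorem: mixed law + ends–Hankel laws (Steps 2–3)

HONEST FRAMING. Part of the Lean index of the computation cell `pub-hsemireg` (second enclosure wave, cut by seat p6 in the
conventions of seat p3's ENCLOSURE-PLAN-p3.md / build.py from th-7's kernel assets).  Finite-dimensional exterior algebra over a field ONLY:
no variety, no cohomology theory, no semiregularity map is constructed here; nothing here says that HC / HC_CM / HC_AV holds;
no Literature fact is declared or used.  The geometric DICTIONARY (why these ranks are the `HT`-side box ranks of the cell's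
STRUCTURE.md §1 / theory/FORMULA-N.md) lives in theory/FORMULA-N-th7.md PART B §A.3 / §N and is NOT asserted in Lean.

th-7's PART S — THE W-PURITY STRUCTURE THEOREM and the ENDS–HANKEL LAWS (theory/th7/WPurityStructure.lean, PART S (text byte-identical in v1 32560e5540b4ccde / v2 a1636d8e15c55ff0 / v3 ae498f7d4ae161bb; th-7 g7, 2026-08-23; the file = WeilRank.lean v3 7e5d6bad1a94e25a — the wave-1 WR source — with PARTs S, S2, S3 inserted before its final `end HSemiregWeil`; ×2 farm + negative controls at p6 g7)), VERBATIM up to the namespace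
(`HSemiregWeil` ↦ `Summit.Ventures.HSemireg.Wedge.Weil`, as the nine `WedgeWeil*.lean` files): W-PURITY(ρ) derivation Steps 2–3 in the kernel
(FORMULA-N PART B §L.5; theory/th7/W-PURITY-RHO-DERIVATION-th7.md) — every `q` (any Hankel rank ρ), every `a, b`, every field, sign-free:
(i) `map_v_Mm_eq_map_f` — on the mixed part `θ ∧ v = θ ∧ f`; (ii) **`finrank_range_wedge_vW_eq`** (signature `(p, N−p)`, every degree `m ≤ N − p`):
`finrank range(∧v ∣ ⋀^m) = |MXm|·rank H_m(q) + finrank range(∧v ∣ Ends)`, Ends `= ⋀^m V₋ ⊕ ⋀^m V₊` (mixed and ends images independent by K-weight windows);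
(iii) **`weilPurity_structure`** (`(n,n)`, `m = n ≥ 1`): `finrank + 2ρ = C(2n,n)·ρ + finrank(Ends block)`, i.e. rank = `(C(2n,n) − 2)·ρ + rank(Ends block)`;
(iv) ENDS–HANKEL laws `finrank_map_f_EndL` / `finrank_map_f_EndR` / `finrank_map_f_Ends_nn`: `rank(∧f ∣ ⋀^p V₋) = rank H_p(q)`, `rank(∧f ∣ ⋀^{N−p} V₊) = rank H_{N−p}(q)`.
CONSEQUENCE: W-PURITY(ρ) is thereby REDUCED in the kernel to the `(n+1)`-dimensional ENDS-BLOCK statement; Step 4 (Schur complement) stays derived ×2, NOT here.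
-/

open Module Set Set.powersetCard Summit.Ventures.HSemireg.Wedge.Hankel

namespace Summit.Ventures.HSemireg.Wedge.Weil

variable (K : Type*) [Field K]

/-! ## PART S (th-7 g7, 2026-08-23) — THE W-PURITY STRUCTURE THEOREM (FORMULA-N PART B §L.5, derivation Steps 2–3 in the kernel)
For `v = f + a·w₊ + b·w₋` on signature `(p, N − p)` in ANY degree `m ≤ N − p` (the PURITY degree is `N = n + n`,
`p = m = n`, where PART R2's separation hypothesis `m + 1 ≤ N − p` fails), ANY `q, a, b`, ANY field:
* `map_v_Mm_eq_map_f` — on the MIXED part `Mm` (monomials meeting both generator blocks) `θ ∧ v = θ ∧ f`;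
* `finrank_range_wedge_vW_eq` — **STRUCTURE THEOREM**: `range(∧v ∣ Λ^m) = range(∧f ∣ Mixed) ⊕ range(∧v ∣ Ends)` at the
  level of dimensions: `finrank range(∧v ∣ Λ^m) = |MXm|·ρ_m + finrank range(∧v ∣ Ends)`, `Ends = Λ^m V₋ ⊕ Λ^m V₊`
  (monomials inside the first `p` pairs or inside the last `N − p` pairs), `ρ_m = rank H_m(q)`; the MIXED LAW
  `finrank range(∧f ∣ Mixed) = |MXm|·ρ_m` is PART R2's `finrank_map_f_Mm`, `|MXm| + C(p,m) + C(N−p,m) = C(N,m)`;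
* `weilPurity_structure` — the purity degree `(n,n)`, `m = n`, `1 ≤ n`:
  `finrank range(∧v ∣ Λⁿ) + 2ρ = C(2n,n)·ρ + finrank range(∧v ∣ Ends)`, i.e. `rank = (C(2n,n) − 2)ρ + rank(Ends block)`;
* `finrank_map_f_EndL` / `finrank_map_f_EndR` — **ENDS–HANKEL LAWS**: `rank(∧f ∣ Λ^p V₋) = rank H_p(q)` and
  `rank(∧f ∣ Λ^{N−p} V₊) = rank H_{N−p}(q)` (the coupling block `C` of PART B §L.5 Step 4 has rank ρ).
So W-PURITY(ρ) («rank = C(2n,n)(2+ρ) − 2ρ − dim ker(S(q) − ab)», PART B §L.5 / theory/th7/W-PURITY-RHO-DERIVATION-th7.md)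
is REDUCED IN THE KERNEL to the (n+1)-dimensional ENDS statement `rank(Ends block) = 2C(2n,n) − dim ker(S(q) − ab)`
(Step 4: Schur complement + Flanders + Schur's lemma — NOT done here). Sign-free throughout. -/

section Purity

variable (N : ℕ)

/-- the ENDS of `Λ^m`: degree-`m` monomials inside the first `p` pairs or inside the last `N − p` pairs
(`Λ^m V₋ ⊕ Λ^m V₊`; the complement of the mixed part `Mm`). -/
def Endm (m p : ℕ) (s : Finset (In N)) : Prop := s.card = m ∧ (s ⊆ Dm N p ∨ s ⊆ Gm N p)

/-- `Ends = Λ^m V₋ ⊕ Λ^m V₊ ⊂ Λ^m N`. -/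
noncomputable def Em (m p : ℕ) : Submodule K (HT K (In N)) := Sp K (Endm N m p)

/-- the K-weight window of the MIXED image `(Mm) ∧ f`: `N − p < μ < N − p + m`. -/
def Wmid (m p : ℕ) (r : Finset (In N)) : Prop := N - p + 1 ≤ μ p r ∧ μ p r + 1 ≤ N - p + m

variable {N}

/-- the ends `Em` of `⋀^m` lie in the degree-`m` homogeneous part. -/
lemma Em_le_Hom (m p : ℕ) : Em K N m p ≤ Hom K (In N) Finset.univ m :=
  Sp_mono fun s hs => ⟨Finset.subset_univ s, hs.1⟩

/-- `Λ^m V₋ ≤ Ends`, `Λ^m V₊ ≤ Ends`. -/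
lemma Hom_Dm_le_Em (m p : ℕ) : Hom K (In N) (Dm N p) m ≤ Em K N m p :=
  Sp_mono fun _ hs => ⟨hs.2, Or.inl hs.1⟩

/-- degree-`m` monomials inside the last `N − p` pairs lie in the ends `Em`. -/
lemma Hom_Gm_le_Em (m p : ℕ) : Hom K (In N) (Gm N p) m ≤ Em K N m p :=
  Sp_mono fun _ hs => ⟨hs.2, Or.inr hs.1⟩

/-- `Λ^m N = Mixed ⊔ Ends`. -/
lemma Hom_univ_eq_Mm_sup_Em (m p : ℕ) : Hom K (In N) Finset.univ m = Mm K N m p ⊔ Em K N m p := by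
  apply le_antisymm
  · rw [Hom_univ_eq_Sp, Sp]
    apply Submodule.span_le.mpr
    rintro _ ⟨s, ⟨-, hs⟩, rfl⟩
    by_cases h1 : s ⊆ Dm N p
    · exact Submodule.mem_sup_right (B_mem_Sp ⟨hs, Or.inl h1⟩)
    · by_cases h2 : s ⊆ Gm N p
      · exact Submodule.mem_sup_right (B_mem_Sp ⟨hs, Or.inr h2⟩)
      · exact Submodule.mem_sup_left (B_mem_Sp ⟨hs, h1, h2⟩)
  · exact sup_le (Mm_le_Hom K m p) (Em_le_Hom K m p)

/-- on the mixed part `θ ∧ v = θ ∧ f` (both block monomials kill a mixed monomial). -/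
lemma map_v_Mm_eq_map_f (m p : ℕ) (q : ℕ → K) (a b : K) :
    (Mm K N m p).map (LinearMap.mulRight K (vW K N p q a b)) =
      (Mm K N m p).map (LinearMap.mulRight K (w K N N q)) := by
  have key : ∀ θ ∈ Mm K N m p, θ * vW K N p q a b = θ * w K N N q := by
    intro θ hθ
    obtain ⟨h1, h2⟩ := mul_blocks_eq_zero_of_mem_Mm K hθ
    rw [vW_mul_expand, h1, h2, smul_zero, smul_zero, add_zero, add_zero]
  apply le_antisymm
  · rw [Submodule.map_le_iff_le_comap]
    intro θ hθ
    rw [Submodule.mem_comap, LinearMap.mulRight_apply, key θ hθ]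
    exact Submodule.mem_map_of_mem hθ
  · rw [Submodule.map_le_iff_le_comap]
    intro θ hθ
    rw [Submodule.mem_comap, LinearMap.mulRight_apply, ← key θ hθ]
    exact Submodule.mem_map_of_mem hθ

/-- the mixed image sits in the middle weight window. -/
lemma map_f_Mm_le_Wmid (m p : ℕ) (q : ℕ → K) :
    (Mm K N m p).map (LinearMap.mulRight K (w K N N q)) ≤ Sp K (Wmid N m p) := by
  rw [Submodule.map_le_iff_le_comap]
  intro θ hθ
  rw [Submodule.mem_comap, LinearMap.mulRight_apply]
  refine mul_mem_Sp (P := Mixm N m p) (Q := Fsupp (N := N) p) (R := Wmid N m p) ?_ hθ (f_mem_Sp K p q)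
  intro s t hst hs ht
  obtain ⟨hcard, hD, hG⟩ := hs
  obtain ⟨i, his, hi⟩ := Finset.not_subset.mp hD
  obtain ⟨j, hjs, hj⟩ := Finset.not_subset.mp hG
  have hμ1 : 1 ≤ μ p s := by
    unfold μ
    exact Finset.card_pos.mpr ⟨i, Finset.mem_inter.mpr ⟨his, mem_Gm_of_not_mem_Dm hi⟩⟩
  have hμ2 : μ p s + 1 ≤ s.card := by
    unfold μ
    have hsub : s ∩ Gm N p ⊆ s.erase j := by
      intro x hx
      rw [Finset.mem_erase]
      refine ⟨fun hxj => hj (hxj ▸ (Finset.mem_inter.mp hx).2), (Finset.mem_inter.mp hx).1⟩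
    have := Finset.card_le_card hsub
    rw [Finset.card_erase_of_mem hjs] at this
    have hpos : 0 < s.card := Finset.card_pos.mpr ⟨j, hjs⟩
    omega
  refine ⟨?_, ?_⟩ <;> rw [μ_union hst, ht.2] <;> omega

/-- the ends image avoids the middle weight window (for `m ≤ N − p`). -/
lemma map_v_Em_le_notWmid {m p : ℕ} (hp : p ≤ N) (hmN : m ≤ N - p) (q : ℕ → K) (a b : K) :
    (Em K N m p).map (LinearMap.mulRight K (vW K N p q a b)) ≤ Sp K (fun r => ¬ Wmid N m p r) := by
  rw [Submodule.map_le_iff_le_comap]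
  intro θ hθ
  rw [Submodule.mem_comap, LinearMap.mulRight_apply, vW_mul_expand]
  refine Submodule.add_mem _ (Submodule.add_mem _ ?_ (Submodule.smul_mem _ _ ?_)) (Submodule.smul_mem _ _ ?_)
  · refine mul_mem_Sp (P := Endm N m p) (Q := Fsupp (N := N) p) (R := fun r => ¬ Wmid N m p r) ?_ hθ
      (f_mem_Sp K p q)
    intro s t hst hs ht hW
    unfold Wmid at hW
    rw [μ_union hst, ht.2] at hW
    rcases hs.2 with h | h
    · have : μ p s = 0 := by
        unfold μ
        rw [Finset.card_eq_zero, ← Finset.disjoint_iff_inter_eq_empty]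
        exact Finset.disjoint_of_subset_left h (disjoint_Dm_Gm p)
      omega
    · have : μ p s = m := by
        unfold μ
        rw [Finset.inter_eq_left.mpr h, hs.1]
      omega
  · refine mul_mem_Sp (P := Endm N m p) (Q := fun t => t = Gm N p) (R := fun r => ¬ Wmid N m p r) ?_ hθ
      (B_mem_Sp rfl)
    intro s t hst hs ht hW
    subst ht
    unfold Wmid at hW
    rw [μ_union hst, μ_Gm, card_Gm hp] at hW
    omega
  · refine mul_mem_Sp (P := Endm N m p) (Q := fun t => t = Dm N p) (R := fun r => ¬ Wmid N m p r) ?_ hθ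
      (B_mem_Sp rfl)
    intro s t hst hs ht hW
    subst ht
    unfold Wmid at hW
    rw [μ_union hst, μ_Dm] at hW
    have : μ p s ≤ m := (μ_le_card s).trans hs.1.le
    omega

/-- **W-PURITY STRUCTURE THEOREM (signature (p, N−p), degree m ≤ N − p; ANY q, a, b, ANY field).**
(`p ≤ N`) `finrank range(θ ↦ θ ∧ v on Λ^m N) = |MXm|·rank H_m(q) + finrank range(∧v ∣ Ends)` — the mixed part contributes
`θ ∧ f` only, with PART R2's rank `|MXm|·ρ_m`, and its image is INDEPENDENT of the ends image (K-weight windows). -/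
theorem finrank_range_wedge_vW_eq {m p : ℕ} (hp : p ≤ N) (hmN : m ≤ N - p) (q : ℕ → K) (a b : K) :
    Module.finrank K (LinearMap.range (wedge K N m (vW K N p q a b))) =
      (MXm N m p).card * (hankel1 K N m q).rank +
        Module.finrank K ↥((Em K N m p).map (LinearMap.mulRight K (vW K N p q a b))) := by
  classical
  rw [range_wedge, Hom_univ_eq_Mm_sup_Em K m p, Submodule.map_sup, map_v_Mm_eq_map_f K m p q a b,
    ← finrank_map_f_Mm K q]
  have hinf : (Mm K N m p).map (LinearMap.mulRight K (w K N N q)) ⊓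
      (Em K N m p).map (LinearMap.mulRight K (vW K N p q a b)) = ⊥ := by
    rw [eq_bot_iff]
    calc (Mm K N m p).map (LinearMap.mulRight K (w K N N q)) ⊓
          (Em K N m p).map (LinearMap.mulRight K (vW K N p q a b))
          ≤ Sp K (Wmid N m p) ⊓ Sp K (fun r => ¬ Wmid N m p r) :=
          inf_le_inf (map_f_Mm_le_Wmid K m p q) (map_v_Em_le_notWmid K hp hmN q a b)
      _ = ⊥ := Sp_inf_Sp_eq_bot fun s hs hn => hn hs
  have h := Submodule.finrank_sup_add_finrank_inf_eq
    ((Mm K N m p).map (LinearMap.mulRight K (w K N N q)))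
    ((Em K N m p).map (LinearMap.mulRight K (vW K N p q a b)))
  rw [hinf, finrank_bot, add_zero] at h
  exact h

/-- **THE PURITY DEGREE (Weil type (n,n), m = n, n ≥ 1; PART B §L.5 Steps 2–3):**
`finrank range(∧v ∣ Λⁿ) + 2ρ = C(2n,n)·ρ + finrank range(∧v ∣ Ends)`, ρ = rank H_n(q) — i.e.
`rank(∧v ∣ HTⁿ) = (C(2n,n) − 2)·ρ + rank(Ends block)` for EVERY q, a, b and every field. -/
theorem weilPurity_structure {n : ℕ} (hn : 1 ≤ n) (q : ℕ → K) (a b : K) :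
    Module.finrank K (LinearMap.range (wedge K (n + n) n (vW K (n + n) n q a b))) +
        2 * (hankel1 K (n + n) n q).rank =
      (n + n).choose n * (hankel1 K (n + n) n q).rank +
        Module.finrank K ↥((Em K (n + n) n n).map (LinearMap.mulRight K (vW K (n + n) n q a b))) := by
  have h := finrank_range_wedge_vW_eq K (N := n + n) (p := n) (m := n) (by omega) (by omega) q a b
  have hMX := card_MXm (N := n + n) (m := n) (p := n) hn (by omega)
  rw [Nat.add_sub_cancel_left, Nat.choose_self] at hMX
  rw [h]
  have : (n + n).choose n * (hankel1 K (n + n) n q).rank =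
      (MXm (n + n) n n).card * (hankel1 K (n + n) n q).rank + 2 * (hankel1 K (n + n) n q).rank := by
    rw [← hMX]; ring
  omega

/-! ### The ENDS–HANKEL laws: `rank(∧f ∣ Λ^p V₋) = ρ_p`, `rank(∧f ∣ Λ^{N−p} V₊) = ρ_{N−p}` -/

/-- a selection of ALL the first `p` pairs is a degree-`p` monomial inside `V₋`, and conversely up to full pairs. -/
lemma map_f_Hom_Dm_eq {p : ℕ} (hp : p ≤ N) (q : ℕ → K) :
    (Hom K (In N) (Dm N p) p).map (LinearMap.mulRight K (w K N N q)) =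
      (Sp K (Sel N (Ap N p))).map (LinearMap.mulRight K (w K N N q)) := by
  classical
  apply le_antisymm
  · rw [Submodule.map_le_iff_le_comap, Hom]
    apply Submodule.span_le.mpr
    rintro _ ⟨t, ⟨htD, ht⟩, rfl⟩
    rw [SetLike.mem_coe, Submodule.mem_comap, LinearMap.mulRight_apply]
    dsimp only
    rcases sel_or_pair (N := N) t with hsel | ⟨i, hi, hpi⟩
    · have hS : t.image pr = Ap N p := by
        apply Finset.eq_of_subset_of_card_le
        · intro c hc
          obtain ⟨i, hi, rfl⟩ := Finset.mem_image.mp hc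
          exact mem_Ap.mpr ((mem_Dm_iff i).mp (htD hi))
        · rw [card_Ap hp, ← hsel.1, ht]
      rw [hS] at hsel
      exact Submodule.mem_map_of_mem (B_mem_Sp hsel)
    · rw [B_mul_f_eq_zero_of_pair K hi hpi]; exact Submodule.zero_mem _
  · refine Submodule.map_mono (Sp_mono fun t ht => ⟨?_, by rw [ht.1, card_Ap hp]⟩)
    intro i hi
    have : pr i ∈ Ap N p := ht.2 ▸ Finset.mem_image_of_mem pr hi
    exact (mem_Dm_iff i).mpr (mem_Ap.mp this)

/-- the image of the degree-`m` monomials of the last `N − p` pairs under `∧ f`, as a selection piece. -/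
lemma map_f_Hom_Gm_eq {p : ℕ} (hp : p ≤ N) (q : ℕ → K) :
    (Hom K (In N) (Gm N p) (N - p)).map (LinearMap.mulRight K (w K N N q)) =
      (Sp K (Sel N (Am N p))).map (LinearMap.mulRight K (w K N N q)) := by
  classical
  apply le_antisymm
  · rw [Submodule.map_le_iff_le_comap, Hom]
    apply Submodule.span_le.mpr
    rintro _ ⟨t, ⟨htG, ht⟩, rfl⟩
    rw [SetLike.mem_coe, Submodule.mem_comap, LinearMap.mulRight_apply]
    dsimp only
    rcases sel_or_pair (N := N) t with hsel | ⟨i, hi, hpi⟩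
    · have hS : t.image pr = Am N p := by
        apply Finset.eq_of_subset_of_card_le
        · intro c hc
          obtain ⟨i, hi, rfl⟩ := Finset.mem_image.mp hc
          exact mem_Am.mpr ((mem_Gm_iff i).mp (htG hi))
        · rw [card_Am hp, ← hsel.1, ht]
      rw [hS] at hsel
      exact Submodule.mem_map_of_mem (B_mem_Sp hsel)
    · rw [B_mul_f_eq_zero_of_pair K hi hpi]; exact Submodule.zero_mem _
  · refine Submodule.map_mono (Sp_mono fun t ht => ⟨?_, by rw [ht.1, card_Am hp]⟩)
    intro i hi
    have : pr i ∈ Am N p := ht.2 ▸ Finset.mem_image_of_mem pr hi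
    exact (mem_Gm_iff i).mpr (mem_Am.mp this)

/-- **ENDS–HANKEL LAW (left end): `rank(θ ↦ θ ∧ f on Λ^p V₋) = rank H_p(q)`** (`V₋` = the first `p` pairs;
PART B §L.5 Step 4's coupling block `C` has rank ρ). Every field, every `q`. -/
theorem finrank_map_f_EndL {p : ℕ} (hp : p ≤ N) (q : ℕ → K) :
    Module.finrank K ↥((Hom K (In N) (Dm N p) p).map (LinearMap.mulRight K (w K N N q))) =
      (hankel1 K N p q).rank := by
  classical
  rw [map_f_Hom_Dm_eq K hp q]
  exact finrank_map_f_Sel K (card_Ap hp) q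

/-- **ENDS–HANKEL LAW (right end): `rank(θ ↦ θ ∧ f on Λ^{N−p} V₊) = rank H_{N−p}(q)`.** -/
theorem finrank_map_f_EndR {p : ℕ} (hp : p ≤ N) (q : ℕ → K) :
    Module.finrank K ↥((Hom K (In N) (Gm N p) (N - p)).map (LinearMap.mulRight K (w K N N q))) =
      (hankel1 K N (N - p) q).rank := by
  classical
  rw [map_f_Hom_Gm_eq K hp q]
  exact finrank_map_f_Sel K (card_Am hp) q

/-- the purity-degree instances: on Weil type `(n,n)` both ends of `Λⁿ` have `∧f`-rank `ρ = rank H_n(q)`. -/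
theorem finrank_map_f_Ends_nn (n : ℕ) (q : ℕ → K) :
    Module.finrank K ↥((Hom K (In (n + n)) (Dm (n + n) n) n).map (LinearMap.mulRight K (w K (n + n) (n + n) q))) =
        (hankel1 K (n + n) n q).rank ∧
      Module.finrank K ↥((Hom K (In (n + n)) (Gm (n + n) n) n).map (LinearMap.mulRight K (w K (n + n) (n + n) q))) =
        (hankel1 K (n + n) n q).rank := by
  refine ⟨finrank_map_f_EndL K (N := n + n) (p := n) (by omega) q, ?_⟩
  have h := finrank_map_f_EndR K (N := n + n) (p := n) (by omega) q
  rw [Nat.add_sub_cancel_left] at h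
  exact h

end Purity

end Summit.Ventures.HSemireg.Wedge.Weil
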